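import Summits.NavierStokesRegularity.NavierStokesRegularity.Theorems.AxisTwistDoorAveragedConeLiouvilleRegularShell
import Literature.Analysis.FluidPDE.SereginSverakAxisymmetric
import HarnessLib

/-!
# A5 input (Lei–Ren–Tian 2025, Thm 1.1), piece P1a: THE FLAT PARABOLIC GAUGE AND ITS GAP LEMMA

Cell pub/ns-inputs, TABLE A row A5 (`LeiRenTian2025_doubleCone_regularity`), recon memo `kits/A5-recon-ser-b.md`
(cut P1 = the shell-of-regularity input, design point D3), seat ns-in-lit-a5 g0's key «P1 = ser-b» (STATUS
2026-08-28T19:35:26Z).  Toward `DoubleCone.Shell.exists_uniform_flatShell` — Lei–Ren–Tian's Lemma 2.4 (= Lei–Ren 2024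
Thm 2 + Rmk 8, "quantitative shells of regularity") in the COMPACTNESS form their §4 consumes: a flat parabolic shell
`𝒬(a+δ) ∖ 𝒬(a−δ)` (`𝒬(r) = (−r², 0) × {|x_h| < r, |x₃| < r}` = `SereginSverak2009.parCyl 0 r`) of regularity with
`δ ≥ δ₀(K)` and bounds depending only on `K ≥ ‖u‖_{L³(Q₁)} + ‖p‖_{L^{3/2}(Q₁)}`.

This file is the measure-theoretic core, the space–time twin of `RadialGap.exists_gap_of_isParabolicNull` (p-id of
the 26889 programme R2): the FLAT PARABOLIC GAUGE `ϱ(t, x) = max(|x_h|, |x₃|, √(−t))` — whose sub-level sets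
`{ϱ < r} ∩ {t < 0}` are exactly the flat cylinders `𝒬(r)` — is `1`-Lipschitz for the parabolic metric
(`|ϱ(w) − ϱ(z)| ≤ ρ` for `w ∈ Q*_ρ(z)`), and a compact `𝒫¹`-null set leaves a whole interval of values of any such
function free.  Applied to the singular set this yields a PARABOLIC shell of regularity: lateral part, `x₃`-caps AND
the initial time layer `−(a+δ)² < t < −(a−δ)²` (Lei–Ren–Tian's domain `𝒟₁` lives in the latter).

* `abs_sqrt_sub_sqrt_le` — `|√a − √b| ≤ √|a − b|` (all reals; `1/2`-Hölder continuity of `√`).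
* `abs_gauge_sub_gauge_le` — the gauge is parabolic-`1`-Lipschitz on centred cylinders.
* `continuous_gauge`, `gauge_lt_iff_mem_parCyl` and small `√(−t)` bookkeeping lemmas.
* `exists_gap_of_isParabolicNull_of_parabolicLipschitz` — the gap lemma for parabolic-Lipschitz space–time functions;
  `exists_gauge_gap_of_isParabolicNull` — its instance for the gauge.
(`‖x‖ ≤ |x_h| + |x₃|` is the tree's `norm_le_cylRadius_add_abs_apply_two`, `CylindricalCutoff.lean`.)

Pure measure theory / topology; no Navier–Stokes content; theorems only (no `def`).  WHAT THIS IS NOT: not a statement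
about Navier–Stokes regularity; a brick of a re-proof of a PRINTED partial-regularity lemma serving the INPUT A5; items
0155 / 15453 and the summit stay OPEN.  `--supports stmt-NavierStokesRegularity-0155 --as helper`.
[cite: LeiRenTian2025, Lemma 2.4 and §2.2 (arXiv:2501.08976 p. 6)] [cite: CaffarelliKohnNirenberg1982, Theorem B, §6]
-/

noncomputable section

set_option linter.dupNamespace false

namespace Summit.NavierStokesRegularity.NavierStokesRegularity.Theorems.DoubleCone.Shell

open scoped ENNReal NNReal Topology
open Set Function MeasureTheory Metric Filter
open Literature.Analysis.FluidPDE
open Summit.NavierStokesRegularity.NavierStokesRegularity.Theorems.AveragedConeLiouville.RadialGap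
open Summit.NavierStokesRegularity.NavierStokesRegularity.Theorems.AveragedConeLiouville.RegularShell

/-! ### `√` is `1/2`-Hölder -/

/-- `√a ≤ √b + √|a − b|` for all reals. [folklore] -/
theorem sqrt_le_sqrt_add_sqrt_abs_sub (a b : ℝ) :
    Real.sqrt a ≤ Real.sqrt b + Real.sqrt |a - b| := by
  rcases le_or_gt a 0 with ha | ha
  · rw [Real.sqrt_eq_zero'.2 ha]; positivity
  rcases le_or_gt b 0 with hb | hb
  · rw [Real.sqrt_eq_zero'.2 hb, zero_add]
    exact Real.sqrt_le_sqrt (by rw [abs_of_nonneg (by linarith)]; linarith)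
  -- subadditivity `√(x + y) ≤ √x + √y` on the nonnegative reals (as in the tree's MRT2015 toolkit), inlined
  have h1 : 0 ≤ Real.sqrt b := Real.sqrt_nonneg b
  have h2 : 0 ≤ Real.sqrt |a - b| := Real.sqrt_nonneg _
  calc Real.sqrt a ≤ Real.sqrt (b + |a - b|) := Real.sqrt_le_sqrt (by linarith [le_abs_self (a - b)])
    _ ≤ Real.sqrt ((Real.sqrt b + Real.sqrt |a - b|) ^ 2) := by
        refine Real.sqrt_le_sqrt ?_
        nlinarith [Real.sq_sqrt hb.le, Real.sq_sqrt (abs_nonneg (a - b)), mul_nonneg h1 h2]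
    _ = Real.sqrt b + Real.sqrt |a - b| := Real.sqrt_sq (by positivity)

/-- **`1/2`-Hölder continuity of the square root**: `|√a − √b| ≤ √|a − b|` for all reals. [folklore] -/
theorem abs_sqrt_sub_sqrt_le (a b : ℝ) : |Real.sqrt a - Real.sqrt b| ≤ Real.sqrt |a - b| := by
  rw [abs_sub_le_iff]
  constructor
  · linarith [sqrt_le_sqrt_add_sqrt_abs_sub a b]
  · have h := sqrt_le_sqrt_add_sqrt_abs_sub b a
    rw [abs_sub_comm] at h
    linarith

/-! ### The flat parabolic gauge `ϱ(t, x) = max(|x_h|, |x₃|, √(−t))` -/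

/-- **The flat parabolic gauge is parabolic-`1`-Lipschitz**: for `w` in the centred cylinder `Q*_ρ(z)`,
`|ϱ(w) − ϱ(z)| ≤ ρ`, `ϱ(t, x) = max(max(|x_h|, |x₃|), √(−t))`.  (Each entry moves by less than `ρ`: the two spatial
ones are `1`-Lipschitz in `x` and `‖x − x_z‖ < ρ`; `|√(−t) − √(−t_z)| ≤ √|t − t_z| < √(ρ²) = ρ`.) [folklore] -/
theorem abs_gauge_sub_gauge_le {ρ : ℝ} {z w : ℝ × EuclideanSpace ℝ (Fin 3)}
    (hw : w ∈ parabolicCylinderCentered ρ z) :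
    |max (max (cylRadius w.2) |w.2 2|) (Real.sqrt (-w.1)) -
        max (max (cylRadius z.2) |z.2 2|) (Real.sqrt (-z.1))| ≤ ρ := by
  rw [mem_parabolicCylinderCentered] at hw
  obtain ⟨⟨ht1, ht2⟩, hx⟩ := hw
  have hρ : 0 < ρ := lt_of_le_of_lt dist_nonneg hx
  rw [dist_eq_norm] at hx
  -- the three entries
  have h1 : |cylRadius w.2 - cylRadius z.2| ≤ ρ := by
    have h := lipschitzWith_cylRadius.dist_le_mul w.2 z.2
    rw [NNReal.coe_one, one_mul, Real.dist_eq, dist_eq_norm] at h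
    exact h.trans hx.le
  have h2 : abs (abs (w.2 2) - abs (z.2 2)) ≤ ρ := by
    refine (abs_abs_sub_abs_le_abs_sub _ _).trans ?_
    have h : abs (w.2 2 - z.2 2) = abs ((w.2 - z.2) 2) := by simp
    rw [h]
    have hc : abs ((w.2 - z.2) 2) ≤ ‖w.2 - z.2‖ := by
      simpa only [Real.norm_eq_abs] using PiLp.norm_apply_le (w.2 - z.2) 2
    exact hc.trans hx.le
  have h3 : |Real.sqrt (-w.1) - Real.sqrt (-z.1)| ≤ ρ := by
    refine (abs_sqrt_sub_sqrt_le _ _).trans ?_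
    have habs : |(-w.1) - (-z.1)| ≤ ρ ^ 2 := by
      rw [abs_le]; constructor <;> linarith
    calc Real.sqrt |(-w.1) - (-z.1)| ≤ Real.sqrt (ρ ^ 2) := Real.sqrt_le_sqrt habs
      _ = ρ := Real.sqrt_sq hρ.le
  -- `|max − max| ≤ max |−|`
  refine (abs_max_sub_max_le_max _ _ _ _).trans (max_le ?_ h3)
  exact (abs_max_sub_max_le_max _ _ _ _).trans (max_le h1 h2)

/-- The flat parabolic gauge is continuous. [folklore] -/
theorem continuous_gauge :
    Continuous fun w : ℝ × EuclideanSpace ℝ (Fin 3) =>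
      max (max (cylRadius w.2) |w.2 2|) (Real.sqrt (-w.1)) := by
  have h1 : Continuous fun w : ℝ × EuclideanSpace ℝ (Fin 3) => cylRadius w.2 :=
    continuous_cylRadius.comp continuous_snd
  have h2 : Continuous fun w : ℝ × EuclideanSpace ℝ (Fin 3) => |w.2 2| := by fun_prop
  have h3 : Continuous fun w : ℝ × EuclideanSpace ℝ (Fin 3) => Real.sqrt (-w.1) := by fun_prop
  exact (h1.max h2).max h3

/-- **Sub-level sets of the gauge are the flat cylinders**: for `t < 0` and `r > 0`,
`ϱ(t, x) < r ↔ (t, x) ∈ 𝒬(r) = SereginSverak2009.parCyl 0 r`. [folklore] -/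
theorem gauge_lt_iff_mem_parCyl {w : ℝ × EuclideanSpace ℝ (Fin 3)} (hw : w.1 < 0) {r : ℝ} (hr : 0 < r) :
    max (max (cylRadius w.2) |w.2 2|) (Real.sqrt (-w.1)) < r ↔ w ∈ SereginSverak2009.parCyl 0 r := by
  rw [SereginSverak2009.mem_parCyl_zero, max_lt_iff, max_lt_iff, mem_Ioo]
  have hsq : Real.sqrt (-w.1) < r ↔ -r ^ 2 < w.1 := by
    rw [Real.sqrt_lt' hr]
    constructor <;> intro h <;> linarith
  rw [hsq]
  tauto

/-- The gauge dominates `√(−t)`: `ϱ(w) < r`, `r > 0` forces `−r² < t`. [folklore] -/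
theorem neg_sq_lt_of_gauge_lt {w : ℝ × EuclideanSpace ℝ (Fin 3)} {r : ℝ} (hr : 0 < r)
    (h : max (max (cylRadius w.2) |w.2 2|) (Real.sqrt (-w.1)) < r) : -r ^ 2 < w.1 := by
  have h3 : Real.sqrt (-w.1) < r := lt_of_le_of_lt (le_max_right _ _) h
  rw [Real.sqrt_lt' hr] at h3
  linarith

/-- Conversely `−r² < t` with `r ≥ 0` gives `√(−t) < r` … no: gives `√(−t) ≤ r` only in the closed form; the strict
form: `−r² < t → √(−t) < r` for `r > 0`. [folklore] -/
theorem sqrt_neg_lt_of_neg_sq_lt {t r : ℝ} (hr : 0 < r) (h : -r ^ 2 < t) : Real.sqrt (-t) < r := by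
  rw [Real.sqrt_lt' hr]; linarith

/-- `√(−t) ≤ r` from `−r² ≤ t`, `r ≥ 0`. [folklore] -/
theorem sqrt_neg_le_of_neg_sq_le {t r : ℝ} (hr : 0 ≤ r) (h : -r ^ 2 ≤ t) : Real.sqrt (-t) ≤ r := by
  rw [Real.sqrt_le_left hr] ; linarith

/-- `a ≤ √(−t)` from `t ≤ −a²` (any real `a`). [folklore] -/
theorem le_sqrt_neg_of_le_neg_sq {t a : ℝ} (h : t ≤ -a ^ 2) : a ≤ Real.sqrt (-t) := by
  rcases le_or_gt a 0 with ha | ha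
  · exact ha.trans (Real.sqrt_nonneg _)
  · rw [Real.le_sqrt' ha]; linarith

/-- `√(−t) < a` fails when `t ≤ −a²`: contrapositive bookkeeping, `a < √(−t) → t < -a^2` for `a ≥ 0`. [folklore] -/
theorem lt_neg_sq_of_lt_sqrt_neg {t a : ℝ} (ha : 0 ≤ a) (h : a < Real.sqrt (-t)) : t < -a ^ 2 := by
  rw [Real.lt_sqrt ha] at h; linarith

/-! ### The gap lemma for parabolic-Lipschitz functions -/

/-- **A compact `𝒫¹`-null set leaves a gap in the values of any parabolic-`1`-Lipschitz space–time function.**  If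
`S ⊆ ℝ × ℝ³` is compact with `𝒫¹(S) = 0`, `φ : ℝ × ℝ³ → ℝ` satisfies `|φ(w) − φ(z)| ≤ ρ` whenever `w ∈ Q*_ρ(z)`, and
`α < β`, then there are `a`, `η > 0` with `α < a − η < a + η < β` such that `φ(w) ∉ [a − η, a + η]` for every
`w ∈ S`.  Proof verbatim as `RadialGap.exists_gap_of_isParabolicNull` (cover by centred cylinders `Q*_{ρᵢ}(zᵢ)` with
`∑ ρᵢ < (β − α)/4`, finite subcover, the values lie in `⋃ [φ(zᵢ) − ρᵢ, φ(zᵢ) + ρᵢ]` of total length `< (β − α)/2`).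
[cite: CaffarelliKohnNirenberg1982, Theorem B and (2.6) (parabolic Hausdorff measure)] -/
theorem exists_gap_of_isParabolicNull_of_parabolicLipschitz {S : Set (ℝ × EuclideanSpace ℝ (Fin 3))}
    (hSc : IsCompact S) (hS : IsParabolicNull 1 S) {φ : ℝ × EuclideanSpace ℝ (Fin 3) → ℝ}
    (hφ : ∀ (ρ : ℝ) (z w : ℝ × EuclideanSpace ℝ (Fin 3)), w ∈ parabolicCylinderCentered ρ z → |φ w - φ z| ≤ ρ)
    {α β : ℝ} (hαβ : α < β) :
    ∃ a η : ℝ, 0 < η ∧ α < a - η ∧ a + η < β ∧ ∀ w ∈ S, φ w < a - η ∨ a + η < φ w := by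
  -- adapted from `…AveragedConeLiouvilleRadialGap.exists_gap_of_isParabolicNull` (space-only Lipschitz functions)
  obtain ⟨z, ρ, hρ, hcov, hsum⟩ := exists_cover_of_isParabolicNull hS (by linarith : 0 < (β - α) / 4)
  obtain ⟨J, hJ⟩ := hSc.elim_finite_subcover (fun i => parabolicCylinderCentered (ρ i) (z i))
    (fun i => isOpen_parabolicCylinderCentered _ _) hcov
  set I : ℕ → Set ℝ := fun i => Icc (φ (z i) - ρ i) (φ (z i) + ρ i) with hI
  have hval : ∀ w ∈ S, ∃ i ∈ J, φ w ∈ I i := by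
    intro w hw
    obtain ⟨i, hi, hwi⟩ := mem_iUnion₂.1 (hJ hw)
    refine ⟨i, hi, ?_⟩
    have hd : |φ w - φ (z i)| ≤ ρ i := hφ (ρ i) (z i) w hwi
    rw [hI]; constructor <;> [linarith [(abs_le.1 hd).1]; linarith [(abs_le.1 hd).2]]
  have hlen : volume (⋃ i ∈ J, I i) < ENNReal.ofReal (β - α) := by
    calc volume (⋃ i ∈ J, I i) ≤ ∑ i ∈ J, volume (I i) := measure_biUnion_finset_le J I
      _ = ∑ i ∈ J, ENNReal.ofReal (2 * ρ i) := by
          refine Finset.sum_congr rfl fun i _ => ?_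
          rw [hI, Real.volume_Icc]
          congr 1; ring
      _ = 2 * ∑ i ∈ J, ENNReal.ofReal (ρ i) := by
          rw [Finset.mul_sum]
          refine Finset.sum_congr rfl fun i _ => ?_
          rw [ENNReal.ofReal_mul (by norm_num), ENNReal.ofReal_ofNat]
      _ ≤ 2 * ∑' i, ENNReal.ofReal (ρ i) := mul_le_mul' le_rfl (ENNReal.sum_le_tsum J)
      _ ≤ 2 * ENNReal.ofReal ((β - α) / 4) := mul_le_mul' le_rfl hsum.le
      _ = ENNReal.ofReal ((β - α) / 2) := by
          rw [← ENNReal.ofReal_ofNat, ← ENNReal.ofReal_mul (by norm_num)]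
          congr 1; ring
      _ < ENNReal.ofReal (β - α) := (ENNReal.ofReal_lt_ofReal_iff (by linarith)).2 (by linarith)
  set U : Set ℝ := Ioo α β \ ⋃ i ∈ J, I i with hU
  have hUo : IsOpen U := isOpen_Ioo.sdiff (isClosed_biUnion_finset fun i _ => isClosed_Icc)
  have hUne : U.Nonempty := by
    by_contra hemp
    rw [not_nonempty_iff_eq_empty] at hemp
    have hsub : Ioo α β ⊆ ⋃ i ∈ J, I i := sdiff_eq_empty.1 hemp
    have h1 : volume (Ioo α β) ≤ volume (⋃ i ∈ J, I i) := measure_mono hsub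
    rw [Real.volume_Ioo] at h1
    exact absurd (h1.trans_lt hlen) (lt_irrefl _)
  obtain ⟨a, haU⟩ := hUne
  obtain ⟨η₀, hη₀, hball⟩ := Metric.isOpen_iff.1 hUo a haU
  refine ⟨a, η₀ / 2, by positivity, ?_, ?_, fun w hw => ?_⟩
  · have : a - η₀ / 2 ∈ U := hball (by rw [mem_ball, Real.dist_eq, abs_of_nonpos (by linarith)]; linarith)
    have := this.1.1; linarith
  · have : a + η₀ / 2 ∈ U := hball (by rw [mem_ball, Real.dist_eq, abs_of_nonneg (by linarith)]; linarith)
    have := this.1.2; linarith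
  · obtain ⟨i, hi, hwi⟩ := hval w hw
    by_contra hcon
    push Not at hcon
    have hmem : φ w ∈ U := hball (by
      rw [mem_ball, Real.dist_eq, abs_lt]; constructor <;> linarith [hcon.1, hcon.2])
    exact hmem.2 (mem_biUnion hi hwi)

/-- **The gap lemma for the flat parabolic gauge.** [cite: CaffarelliKohnNirenberg1982, Theorem B and (2.6)] -/
theorem exists_gauge_gap_of_isParabolicNull {S : Set (ℝ × EuclideanSpace ℝ (Fin 3))}
    (hSc : IsCompact S) (hS : IsParabolicNull 1 S) {α β : ℝ} (hαβ : α < β) :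
    ∃ a η : ℝ, 0 < η ∧ α < a - η ∧ a + η < β ∧ ∀ w ∈ S,
      max (max (cylRadius w.2) |w.2 2|) (Real.sqrt (-w.1)) < a - η ∨
        a + η < max (max (cylRadius w.2) |w.2 2|) (Real.sqrt (-w.1)) :=
  exists_gap_of_isParabolicNull_of_parabolicLipschitz hSc hS (fun _ _ _ hw => abs_gauge_sub_gauge_le hw) hαβ

end Summit.NavierStokesRegularity.NavierStokesRegularity.Theorems.DoubleCone.Shell

end
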